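import Literature.NumberTheory.DiophantineGeometry.TateAlgorithmTameTypesOddProofs
import HarnessLib

/-!
# Tate's algorithm with `2` a unit: a `2`-division root excludes the exits II, IV, IV*, II*

`Proofs` file (theorems only; no definition, no named fact, no instance) in topic
`NumberTheory/DiophantineGeometry`, companion of `Literature.NumberTheory.DiophantineGeometry.TateAlgorithm`
and first half of the kernel proof of **Ogg–Saito at the odd places for a curve with a rational
`2`-torsion point** (`ConductorExponentLeTwoOfTwoTorsionProofs`: `f_v ≤ 2` at `v ∤ 2`, in particular
`ord₃ N_E ≤ 2` over `ℚ`).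

**Statement (DVR form).** Let `R` be a DVR with perfect residue field in which `2` is a unit, `W` a
minimal Weierstrass equation over `R` (`Δ ≠ 0`, Step 11 excluded), and suppose the `2`-division cubic
`ψ₂(x) = 4x³ + b₂x² + 2b₄x + b₆` has a root `x ∈ R`. Then the Kodaira symbol computed by the tree's
literal implementation `WeierstrassCurve.kodairaSymbolOfMinimal` of Tate's algorithm (Silverman, ATAEC
IV.9.4) is `I_{ord Δ}` (Steps 1–2), `III`, `III*` or `Iₙ*` — never `II, IV, IV*, II*` — and hence
`ord Δ ≤ m + 1` (`TateAlgorithm.addVal_Δ_toNat_eq_numComponents_add_one_of_isUnit_two` for the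
types `III, III*, I₀*, Iₙ*`, `TateAlgorithmTameTypesOddProofs`).

**Source / meaning.** Silverman, *Advanced Topics in the Arithmetic of Elliptic Curves* (ATAEC),
GTM 151 (1994), §IV.9 (Tate's algorithm 9.4, Table 4.1, Cor. 9.2) and §IV.10 (Thm 10.2): for the
types `II, IV, IV*, II*` the component group `E(K)/E₀(K)` has order `1` or `3`, `E₀/E₁ ≅ k⁺` is a
`p`-group (`p` odd) and `E₁(K)` has no prime-to-`p` torsion, so `E(K)[2] = 0`; equivalently
(Serre–Tate, Ogg 1967, Saito 1988) a `K`-rational `2`-torsion point makes wild inertia act trivially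
on `E[2]`, so the wild conductor vanishes at `p ≠ 2`.

**Proof given here** (elementary, branch by branch along the algorithm exactly as
`TateAlgorithm.addVal_Δ_toNat_le_numComponents_add_four` of `ConductorExponentLeFiveProofs`):
the root is carried along the `u = 1` translations of Steps 2, 6, 8, 9 (`x ↦ x − r`,
`twoTorsionRoot_smul_of_u_eq_one`), and at the exits II (Step 3: `π ∣ b₂, b₄`, `π ‖ b₆`), IV
(Step 5: `π ∣ b₂`, `π² ∣ b₄`, `π² ‖ b₆`), IV* (Step 8: `π² ∣ b₂`, `π³ ∣ b₄`, `π⁴ ‖ b₆`) and II*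
(Step 10: `π² ∣ b₂`, `π⁴ ∣ b₄`, `π⁵ ‖ b₆`) the equation `4x³ + b₂x² + 2b₄x + b₆ = 0` is impossible:
`π ∣ x`, and comparing `π`-orders of the four terms leaves the exact power of `π` in `b₆` (resp. in
`4x³`) strictly the smallest.

## Main results

* `TateAlgorithm.not_twoTorsionRoot_exitII/IV/IVstar/IIstar` — the four exclusions;
* `TateAlgorithm.kodairaSymbolOfMinimal_of_twoTorsionRoot` — the symbol is `I_{ord Δ}, III, III*, Iₙ*`;
* `TateAlgorithm.addVal_Δ_toNat_le_numComponents_add_one_of_twoTorsionRoot` — `ord Δ ≤ m + 1`;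
* `TateAlgorithm.kodairaSymbolOfMinimal_ne_of_twoTorsionRoot` — `≠ II, IV, IV*, II*`.

## References

* J. H. Silverman, *Advanced Topics in the Arithmetic of Elliptic Curves*, GTM 151, Springer 1994,
  IV.9.2, IV.9.4 and Table 4.1, §IV.10 (Thm 10.2), IV.11.1. [cite: Silverman1994, IV.10.2]
* J. H. Silverman, *The Arithmetic of Elliptic Curves*, GTM 106, 2nd ed. 2009, III.1 Table 3.1
  (`bᵢ` under a change of variables). [cite: SilvermanAEC2009, III.1]
* A. P. Ogg, *Elliptic curves and wild ramification*, Amer. J. Math. 89 (1967) 1–21. [cite: Ogg1967]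
-/

open Polynomial IsLocalRing
open IsDiscreteValuationRing hiding maximalIdeal

namespace Literature.NumberTheory.DiophantineGeometry

namespace TateAlgorithm

/-! ### The `2`-division cubic along the algorithm -/

section Exclusion

variable {R : Type*} [CommRing R] [IsDomain R] [IsDiscreteValuationRing R]

omit [IsDomain R] [IsDiscreteValuationRing R] in
/-- A root of the `2`-division cubic `ψ₂ = 4x³ + b₂x² + 2b₄x + b₆` survives a change of variables
with `u = 1`: `ψ₂^{C • W}(x − r) = ψ₂^{W}(x)` (Silverman AEC III.1, Table 3.1: `b₂' = b₂ + 12r`,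
`b₄' = b₄ + r b₂ + 6r²`, `b₆' = b₆ + 2r b₄ + r² b₂ + 4r³`). [cite: SilvermanAEC2009, III.1 Table 3.1] -/
theorem twoTorsionRoot_smul_of_u_eq_one {C : WeierstrassCurve.VariableChange R} (hu : C.u = 1)
    (W : WeierstrassCurve R) {x : R}
    (hx : 4 * x ^ 3 + W.b₂ * x ^ 2 + 2 * W.b₄ * x + W.b₆ = 0) :
    4 * (x - C.r) ^ 3 + (C • W).b₂ * (x - C.r) ^ 2 + 2 * (C • W).b₄ * (x - C.r) + (C • W).b₆ = 0 := by
  rw [WeierstrassCurve.variableChange_b₂, WeierstrassCurve.variableChange_b₄,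
    WeierstrassCurve.variableChange_b₆, hu, inv_one, Units.val_one]
  linear_combination hx

/-- If `ϖ ∣ b₂, b₄, b₆` then every root of `ψ₂ = 4x³ + b₂x² + 2b₄x + b₆` in `R` lies in `𝔪`
(`4x³ ∈ 𝔪` and `4 ∈ Rˣ`): the `2`-torsion point reduces to the singular point `(0, 0)` of the
Step-2 model (Silverman ATAEC IV.9.4, Step 2). [cite: Silverman1994, IV.9.4 Step 2] -/
theorem dvd_of_twoTorsionRoot {ϖ : R} (hϖ : Irreducible ϖ) (h2 : IsUnit (2 : R))
    (W : WeierstrassCurve R) (hb₂ : ϖ ∣ W.b₂) (hb₄ : ϖ ∣ W.b₄) (hb₆ : ϖ ∣ W.b₆) {x : R}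
    (hx : 4 * x ^ 3 + W.b₂ * x ^ 2 + 2 * W.b₄ * x + W.b₆ = 0) : ϖ ∣ x := by
  obtain ⟨β, hβ⟩ := hb₂
  obtain ⟨B, hB⟩ := hb₄
  obtain ⟨B₆, hB₆⟩ := hb₆
  have h4x : ϖ ∣ 4 * x ^ 3 :=
    ⟨-(β * x ^ 2 + 2 * B * x + B₆), by rw [hβ, hB, hB₆] at hx; linear_combination hx⟩
  have hx3 : ϖ ∣ x ^ 3 := (hϖ.prime.dvd_or_dvd h4x).resolve_left
    fun h ↦ hϖ.not_isUnit (isUnit_of_dvd_unit h (isUnit_four h2))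
  exact hϖ.prime.dvd_of_dvd_pow hx3

/-- **No `2`-division root at the exit II** (Step 3 normal form: `ϖ ∣ b₂, b₄`, `b₆ = ϖ B₆` with
`B₆ ∈ Rˣ`): writing `x = ϖx₁`, `ψ₂(x) = ϖ (4ϖ²x₁³ + ϖ²β x₁² + 2ϖ B x₁ + B₆)`, so `ϖ ∣ B₆`. Néron-model
meaning: type II has trivial component group and additive identity component, so no `2`-torsion
(Silverman ATAEC Table 4.1). [cite: Silverman1994, IV.9.4 Step 3 and Table 4.1] -/
theorem not_twoTorsionRoot_exitII {ϖ : R} (hϖ : Irreducible ϖ) (h2 : IsUnit (2 : R))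
    (W : WeierstrassCurve R) (hb₂ : ϖ ∣ W.b₂) (hb₄ : ϖ ∣ W.b₄) {B₆ : R} (hb₆ : W.b₆ = ϖ * B₆)
    (hB₆ : IsUnit B₆) {x : R} (hx : 4 * x ^ 3 + W.b₂ * x ^ 2 + 2 * W.b₄ * x + W.b₆ = 0) :
    False := by
  obtain ⟨x₁, rfl⟩ := dvd_of_twoTorsionRoot hϖ h2 W hb₂ hb₄ ⟨B₆, hb₆⟩ hx
  obtain ⟨β, hβ⟩ := hb₂
  obtain ⟨B, hB⟩ := hb₄
  have key : ϖ * (B₆ + ϖ * (4 * ϖ * x₁ ^ 3 + ϖ * β * x₁ ^ 2 + 2 * B * x₁)) = 0 := by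
    rw [hβ, hB, hb₆] at hx; linear_combination hx
  have h0 := (mul_eq_zero.mp key).resolve_left hϖ.ne_zero
  refine hϖ.not_isUnit (isUnit_of_dvd_unit ⟨-(4 * ϖ * x₁ ^ 3 + ϖ * β * x₁ ^ 2 + 2 * B * x₁), ?_⟩ hB₆)
  linear_combination h0

/-- **No `2`-division root at the exit IV** (Step 5 normal form: `ϖ ∣ b₂`, `ϖ² ∣ b₄`, `b₆ = ϖ² B₆`
with `B₆ ∈ Rˣ`): with `x = ϖx₁`, `ψ₂(x) = ϖ² (4ϖx₁³ + ϖβx₁² + 2ϖBx₁ + B₆)`. Néron-model meaning: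
type IV has component group of order `3` (Silverman ATAEC Table 4.1). [cite: Silverman1994, IV.9.4 Step 5 and Table 4.1] -/
theorem not_twoTorsionRoot_exitIV {ϖ : R} (hϖ : Irreducible ϖ) (h2 : IsUnit (2 : R))
    (W : WeierstrassCurve R) (hb₂ : ϖ ∣ W.b₂) (hb₄ : ϖ ^ 2 ∣ W.b₄) {B₆ : R}
    (hb₆ : W.b₆ = ϖ ^ 2 * B₆) (hB₆ : IsUnit B₆) {x : R}
    (hx : 4 * x ^ 3 + W.b₂ * x ^ 2 + 2 * W.b₄ * x + W.b₆ = 0) : False := by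
  obtain ⟨x₁, rfl⟩ := dvd_of_twoTorsionRoot hϖ h2 W hb₂ ((dvd_pow_self ϖ two_ne_zero).trans hb₄)
    ⟨ϖ * B₆, by rw [hb₆]; ring⟩ hx
  obtain ⟨β, hβ⟩ := hb₂
  obtain ⟨B, hB⟩ := hb₄
  have key : ϖ ^ 2 * (B₆ + ϖ * (4 * x₁ ^ 3 + β * x₁ ^ 2 + 2 * B * x₁)) = 0 := by
    rw [hβ, hB, hb₆] at hx; linear_combination hx
  have h0 := (mul_eq_zero.mp key).resolve_left (pow_ne_zero 2 hϖ.ne_zero)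
  refine hϖ.not_isUnit (isUnit_of_dvd_unit ⟨-(4 * x₁ ^ 3 + β * x₁ ^ 2 + 2 * B * x₁), ?_⟩ hB₆)
  linear_combination h0

/-- **No `2`-division root at the exit IV*** (Step 8 normal form: `ϖ² ∣ b₂`, `ϖ³ ∣ b₄`,
`b₆ = ϖ⁴ B₆` with `B₆ ∈ Rˣ`): `ψ₂(ϖx₁) = ϖ³(4x₁³ + ϖ(…))` forces `ϖ ∣ x₁`, and then
`ψ₂(ϖ²x₂) = ϖ⁴ (B₆ + ϖ(…))` forces `ϖ ∣ B₆`. Néron-model meaning: type IV* has component group of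
order `3` (Silverman ATAEC Table 4.1). [cite: Silverman1994, IV.9.4 Step 8 and Table 4.1] -/
theorem not_twoTorsionRoot_exitIVstar {ϖ : R} (hϖ : Irreducible ϖ) (h2 : IsUnit (2 : R))
    (W : WeierstrassCurve R) (hb₂ : ϖ ^ 2 ∣ W.b₂) (hb₄ : ϖ ^ 3 ∣ W.b₄) {B₆ : R}
    (hb₆ : W.b₆ = ϖ ^ 4 * B₆) (hB₆ : IsUnit B₆) {x : R}
    (hx : 4 * x ^ 3 + W.b₂ * x ^ 2 + 2 * W.b₄ * x + W.b₆ = 0) : False := by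
  obtain ⟨x₁, rfl⟩ := dvd_of_twoTorsionRoot hϖ h2 W ((dvd_pow_self ϖ two_ne_zero).trans hb₂)
    ((dvd_pow_self ϖ three_ne_zero).trans hb₄) ⟨ϖ ^ 3 * B₆, by rw [hb₆]; ring⟩ hx
  obtain ⟨β, hβ⟩ := hb₂
  obtain ⟨B, hB⟩ := hb₄
  -- first refinement: `ϖ ∣ x₁`
  have key₁ : ϖ ^ 3 * (4 * x₁ ^ 3 + ϖ * (β * x₁ ^ 2 + 2 * B * x₁ + B₆)) = 0 := by
    rw [hβ, hB, hb₆] at hx; linear_combination hx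
  have h₁ := (mul_eq_zero.mp key₁).resolve_left (pow_ne_zero 3 hϖ.ne_zero)
  have h4x : ϖ ∣ 4 * x₁ ^ 3 := ⟨-(β * x₁ ^ 2 + 2 * B * x₁ + B₆), by linear_combination h₁⟩
  have hx3 : ϖ ∣ x₁ ^ 3 := (hϖ.prime.dvd_or_dvd h4x).resolve_left
    fun h ↦ hϖ.not_isUnit (isUnit_of_dvd_unit h (isUnit_four h2))
  obtain ⟨x₂, rfl⟩ := hϖ.prime.dvd_of_dvd_pow hx3
  -- second refinement: `ϖ ∣ B₆`
  have key₂ : ϖ * (B₆ + ϖ * (4 * ϖ * x₂ ^ 3 + ϖ * β * x₂ ^ 2 + 2 * B * x₂)) = 0 := by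
    linear_combination h₁
  have h₂ := (mul_eq_zero.mp key₂).resolve_left hϖ.ne_zero
  refine hϖ.not_isUnit (isUnit_of_dvd_unit ⟨-(4 * ϖ * x₂ ^ 3 + ϖ * β * x₂ ^ 2 + 2 * B * x₂), ?_⟩ hB₆)
  linear_combination h₂

/-- **No `2`-division root at the exit II*** (Step 10 normal form: `ϖ² ∣ b₂`, `ϖ⁴ ∣ b₄`,
`b₆ = ϖ⁵ B₆` with `B₆ ∈ Rˣ`): `ψ₂(ϖx₁) = ϖ³(4x₁³ + ϖ(…))` forces `ϖ ∣ x₁`, and then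
`ψ₂(ϖ²x₂) = ϖ⁵ (B₆ + ϖ(…))` forces `ϖ ∣ B₆`. Néron-model meaning: type II* has trivial component
group (Silverman ATAEC Table 4.1). [cite: Silverman1994, IV.9.4 Step 10 and Table 4.1] -/
theorem not_twoTorsionRoot_exitIIstar {ϖ : R} (hϖ : Irreducible ϖ) (h2 : IsUnit (2 : R))
    (W : WeierstrassCurve R) (hb₂ : ϖ ^ 2 ∣ W.b₂) (hb₄ : ϖ ^ 4 ∣ W.b₄) {B₆ : R}
    (hb₆ : W.b₆ = ϖ ^ 5 * B₆) (hB₆ : IsUnit B₆) {x : R}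
    (hx : 4 * x ^ 3 + W.b₂ * x ^ 2 + 2 * W.b₄ * x + W.b₆ = 0) : False := by
  obtain ⟨x₁, rfl⟩ := dvd_of_twoTorsionRoot hϖ h2 W ((dvd_pow_self ϖ two_ne_zero).trans hb₂)
    ((dvd_pow_self ϖ four_ne_zero).trans hb₄) ⟨ϖ ^ 4 * B₆, by rw [hb₆]; ring⟩ hx
  obtain ⟨β, hβ⟩ := hb₂
  obtain ⟨B, hB⟩ := hb₄
  have key₁ : ϖ ^ 3 * (4 * x₁ ^ 3 + ϖ * (β * x₁ ^ 2 + 2 * ϖ * B * x₁ + ϖ * B₆)) = 0 := by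
    rw [hβ, hB, hb₆] at hx; linear_combination hx
  have h₁ := (mul_eq_zero.mp key₁).resolve_left (pow_ne_zero 3 hϖ.ne_zero)
  have h4x : ϖ ∣ 4 * x₁ ^ 3 :=
    ⟨-(β * x₁ ^ 2 + 2 * ϖ * B * x₁ + ϖ * B₆), by linear_combination h₁⟩
  have hx3 : ϖ ∣ x₁ ^ 3 := (hϖ.prime.dvd_or_dvd h4x).resolve_left
    fun h ↦ hϖ.not_isUnit (isUnit_of_dvd_unit h (isUnit_four h2))
  obtain ⟨x₂, rfl⟩ := hϖ.prime.dvd_of_dvd_pow hx3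
  have key₂ : ϖ ^ 2 * (B₆ + ϖ * (4 * x₂ ^ 3 + β * x₂ ^ 2 + 2 * B * x₂)) = 0 := by
    linear_combination h₁
  have h₂ := (mul_eq_zero.mp key₂).resolve_left (pow_ne_zero 2 hϖ.ne_zero)
  refine hϖ.not_isUnit (isUnit_of_dvd_unit ⟨-(4 * x₂ ^ 3 + β * x₂ ^ 2 + 2 * B * x₂), ?_⟩ hB₆)
  linear_combination h₂

end Exclusion

/-! ### The walk along Tate's algorithm -/

section Main

variable {R : Type*} [CommRing R] [IsDomain R] [IsDiscreteValuationRing R]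

/-- **A `2`-division root confines Tate's algorithm to the exits `I₀, Iₙ, III, I₀*, Iₙ*, III*`.**
Let `R` be a DVR with perfect residue field and `2 ∈ Rˣ`, `W` a Weierstrass equation over `R`
such that no change of variables `(1, r, s, t)` over `R` achieves
`π ∣ a₁, π² ∣ a₂, π³ ∣ a₃, π⁴ ∣ a₄, π⁶ ∣ a₆` (true for a minimal equation, Step 11), and suppose
`ψ₂ = 4x³ + b₂x² + 2b₄x + b₆` has a root in `R`. Then `WeierstrassCurve.kodairaSymbolOfMinimal W`
(Steps 1–10 of Silverman ATAEC IV.9.4, literally) is `I_{ord Δ}` (Steps 1–2), `III`, `III*` or `Iₙ*`: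
the root is carried along the `u = 1` translations (`twoTorsionRoot_smul_of_u_eq_one`) and the exits
II, IV, IV*, II* are contradictory (`not_twoTorsionRoot_exitII/IV/IVstar/IIstar`). This is the
Kodaira-symbol form of "a `K`-rational `2`-torsion point kills the wild conductor at `p ≠ 2`"
(ATAEC IV.10.2; Table 4.1: the types with `E(K)[2] ≠ 0` possible). [cite: Silverman1994, IV.9.4 and Table 4.1] -/
theorem kodairaSymbolOfMinimal_of_twoTorsionRoot [PerfectField (ResidueField R)]
    (h2 : IsUnit (2 : R)) (W : WeierstrassCurve R)
    (hmin : ∀ C : WeierstrassCurve.VariableChange R, C.u = 1 →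
      uniformizer R ∣ (C • W).a₁ → uniformizer R ^ 2 ∣ (C • W).a₂ →
      uniformizer R ^ 3 ∣ (C • W).a₃ → uniformizer R ^ 4 ∣ (C • W).a₄ →
      uniformizer R ^ 6 ∣ (C • W).a₆ → False)
    {x : R} (hx : 4 * x ^ 3 + W.b₂ * x ^ 2 + 2 * W.b₄ * x + W.b₆ = 0) :
    W.kodairaSymbolOfMinimal = .I (addVal R W.Δ).toNat ∨ W.kodairaSymbolOfMinimal = .III ∨
      W.kodairaSymbolOfMinimal = .IIIstar ∨ ∃ n, W.kodairaSymbolOfMinimal = .Istar n := by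
  classical
  have hϖ : Irreducible (uniformizer R) := irreducible_uniformizer
  have h4 : IsUnit (4 : R) := isUnit_four h2
  unfold WeierstrassCurve.kodairaSymbolOfMinimal
  dsimp only
  -- step 1: I₀
  by_cases hΔ : W.Δ ∈ maximalIdeal R
  swap
  · rw [if_pos hΔ]
    have h0 : addVal R W.Δ = 0 := addVal_eq_zero_iff.mpr (notMem_maximalIdeal.mp hΔ)
    rw [h0]
    exact Or.inl rfl
  rw [if_neg (not_not.mpr hΔ)]
  -- step 2 translation (perfect residue field)
  have hex2 := exists_variableChange_step2_of_perfectField W hΔ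
  have hN2 : normalizeStep2 W = hex2.choose • W := dif_pos hex2
  obtain ⟨hu₂, hA₃, hA₄, hA₆⟩ := hex2.choose_spec
  rw [hN2]
  set W₂ := hex2.choose • W with hW₂def
  have hΔ₂ : W₂.Δ = W.Δ := Δ_smul_of_u_eq_one hu₂ W
  have hx₂ := twoTorsionRoot_smul_of_u_eq_one hu₂ W hx
  rw [← hW₂def] at hx₂
  have ha₃ : uniformizer R ∣ W₂.a₃ := (mem_maximalIdeal_iff_dvd_of_irreducible hϖ _).mp hA₃
  have ha₄ : uniformizer R ∣ W₂.a₄ := (mem_maximalIdeal_iff_dvd_of_irreducible hϖ _).mp hA₄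
  have ha₆ : uniformizer R ∣ W₂.a₆ := (mem_maximalIdeal_iff_dvd_of_irreducible hϖ _).mp hA₆
  have hb₄ : uniformizer R ∣ W₂.b₄ := by
    simp only [WeierstrassCurve.b₄]
    exact dvd_add (dvd_mul_of_dvd_right ha₄ _) (dvd_mul_of_dvd_right ha₃ _)
  -- step 2: Iₙ
  by_cases h2t : W₂.b₂ ∈ maximalIdeal R
  swap
  · rw [if_pos h2t]
    exact Or.inl rfl
  rw [if_neg (not_not.mpr h2t)]
  have hb₂ : uniformizer R ∣ W₂.b₂ := (mem_maximalIdeal_iff_dvd_of_irreducible hϖ _).mp h2t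
  -- step 3: II is impossible
  by_cases h3t : W₂.a₆ ∈ maximalIdeal R ^ 2
  swap
  · exfalso
    obtain ⟨γ, hγ⟩ := ha₃
    obtain ⟨ρ, hρ⟩ := ha₆
    have hρu : IsUnit ρ := by
      rw [isUnit_iff_not_dvd hϖ]
      rintro ⟨ρ', rfl⟩
      exact h3t ((mem_maximalIdeal_pow_iff_dvd_of_irreducible hϖ _ _).mpr ⟨ρ', by rw [hρ]; ring⟩)
    have hb₆ : W₂.b₆ = uniformizer R * (4 * ρ + uniformizer R * γ ^ 2) := by
      simp only [WeierstrassCurve.b₆, hγ, hρ]; ring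
    exact not_twoTorsionRoot_exitII hϖ h2 W₂ hb₂ hb₄ hb₆
      (isUnit_add_mul_of_isUnit hϖ (h4.mul hρu) _) hx₂
  rw [if_neg (not_not.mpr h3t)]
  have ha₆' : uniformizer R ^ 2 ∣ W₂.a₆ :=
    (mem_maximalIdeal_pow_iff_dvd_of_irreducible hϖ _ _).mp h3t
  have hb₆₂ : uniformizer R ^ 2 ∣ W₂.b₆ := by
    simp only [WeierstrassCurve.b₆]
    exact dvd_add (pow_dvd_pow_of_dvd ha₃ 2) (dvd_mul_of_dvd_right ha₆' _)
  -- step 4: III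
  by_cases h4t : W₂.b₈ ∈ maximalIdeal R ^ 3
  swap
  · rw [if_pos h4t]
    exact Or.inr (Or.inl rfl)
  rw [if_neg (not_not.mpr h4t)]
  have hb₈ : uniformizer R ^ 3 ∣ W₂.b₈ :=
    (mem_maximalIdeal_pow_iff_dvd_of_irreducible hϖ _ _).mp h4t
  -- step 5: IV is impossible
  by_cases h5t : W₂.b₆ ∈ maximalIdeal R ^ 3
  swap
  · exfalso
    -- `ϖ² ∣ b₄` from `4 b₈ = b₂ b₆ − b₄²`
    have hb₄' : uniformizer R ^ 2 ∣ W₂.b₄ := by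
      have hsq : uniformizer R ^ (2 * 1 + 1) ∣ W₂.b₄ ^ 2 := by
        have e : W₂.b₄ ^ 2 = W₂.b₂ * W₂.b₆ - 4 * W₂.b₈ := by
          rw [WeierstrassCurve.b_relation]; ring
        rw [e, show 2 * 1 + 1 = 3 from rfl]
        refine dvd_sub ?_ (dvd_mul_of_dvd_right hb₈ _)
        rw [pow_succ']
        exact mul_dvd_mul hb₂ hb₆₂
      exact pow_succ_dvd_of_pow_dvd_sq hϖ hsq
    obtain ⟨B₆, hB₆⟩ := hb₆₂
    have hB₆u : IsUnit B₆ := by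
      rw [isUnit_iff_not_dvd hϖ]
      rintro ⟨B', rfl⟩
      exact h5t ((mem_maximalIdeal_pow_iff_dvd_of_irreducible hϖ _ _).mpr ⟨B', by rw [hB₆]; ring⟩)
    exact not_twoTorsionRoot_exitIV hϖ h2 W₂ hb₂ hb₄' hB₆ hB₆u hx₂
  rw [if_neg (not_not.mpr h5t)]
  -- step 6 translation (perfect residue field)
  have hex6 := exists_variableChange_step6_of_perfectField (V := W₂) h2t hA₃ hA₄ h3t h5t h4t
  have hN6 : normalizeStep6 W₂ = hex6.choose • W₂ := dif_pos hex6
  obtain ⟨hu₆, hB₁, hB₂, hB₃, hB₄, hB₆⟩ := hex6.choose_spec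
  rw [hN6]
  set W₆ := hex6.choose • W₂ with hW₆def
  have hx₆ := twoTorsionRoot_smul_of_u_eq_one hu₆ W₂ hx₂
  rw [← hW₆def] at hx₆
  -- step 6: I₀*
  by_cases h6t : distinctRootCount (cubicStep6 W₆) = 3
  · rw [if_pos h6t]
    exact Or.inr (Or.inr (Or.inr ⟨0, rfl⟩))
  rw [if_neg h6t]
  -- step 7: Iₙ*
  by_cases h7t : distinctRootCount (cubicStep6 W₆) = 2
  · rw [if_pos h7t]
    exact Or.inr (Or.inr (Or.inr ⟨_, rfl⟩))
  rw [if_neg h7t]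
  -- step 8 translation: the triple root of `P` is rational over a perfect field
  have hex8 := exists_variableChange_step8_of_perfectField hB₁ hB₂ hB₃ hB₄ hB₆ h6t h7t
  have hN8 : normalizeStep8 W₆ = hex8.choose • W₆ := dif_pos hex8
  obtain ⟨hu₈, hD₁, hD₂, hD₃, hD₄, hD₆⟩ := hex8.choose_spec
  rw [hN8]
  set W₈ := hex8.choose • W₆ with hW₈def
  have hx₈ := twoTorsionRoot_smul_of_u_eq_one hu₈ W₆ hx₆
  rw [← hW₈def] at hx₈
  have h8a₁ := (mem_maximalIdeal_iff_dvd_of_irreducible hϖ _).mp hD₁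
  have h8a₂ := (mem_maximalIdeal_pow_iff_dvd_of_irreducible hϖ _ _).mp hD₂
  have h8a₃ := (mem_maximalIdeal_pow_iff_dvd_of_irreducible hϖ _ _).mp hD₃
  have h8a₄ := (mem_maximalIdeal_pow_iff_dvd_of_irreducible hϖ _ _).mp hD₄
  have h8a₆ := (mem_maximalIdeal_pow_iff_dvd_of_irreducible hϖ _ _).mp hD₆
  -- step 8: IV* is impossible
  by_cases h8t : distinctRootCount (quadraticStep8 W₈) = 2
  · exfalso
    obtain ⟨α, hα⟩ := h8a₁
    obtain ⟨p, hp⟩ := h8a₂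
    obtain ⟨γ, hγ⟩ := h8a₃
    obtain ⟨q, hq⟩ := h8a₄
    obtain ⟨r, hr⟩ := h8a₆
    have hQ : quadraticStep8 W₈ = X ^ 2 + C (residue R γ) * X - C (residue R r) :=
      quadraticStep8_eq hγ hr
    have hB₆u : IsUnit (γ ^ 2 + 4 * r) := by
      rw [hQ, distinctRootCount_monicQuadratic_eq_two_iff h2, ← map_pow, ← map_ofNat (residue R),
        ← map_mul, ← map_add, ← isUnit_iff_residue_ne_zero] at h8t
      exact h8t
    exact not_twoTorsionRoot_exitIVstar hϖ h2 W₈ ⟨_, b₂_step8 W₈ (uniformizer R) hα hp⟩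
      ⟨_, b₄_step8 W₈ (uniformizer R) hα hγ hq⟩ (b₆_step8 W₈ (uniformizer R) hγ hr) hB₆u hx₈
  rw [if_neg h8t]
  -- step 9 translation: the double root of `Y² + a₃,₂ Y − a₆,₄` is rational
  have hex9 := exists_variableChange_step9_of_perfectField hD₁ hD₂ hD₃ hD₄ hD₆ h8t
  have hN9 : normalizeStep9 W₈ = hex9.choose • W₈ := dif_pos hex9
  obtain ⟨hu₉, hE₁, hE₂, hE₃, hE₄, hE₆⟩ := hex9.choose_spec
  rw [hN9]
  set W₉ := hex9.choose • W₈ with hW₉def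
  have hx₉ := twoTorsionRoot_smul_of_u_eq_one hu₉ W₈ hx₈
  rw [← hW₉def] at hx₉
  have h9a₁ := (mem_maximalIdeal_iff_dvd_of_irreducible hϖ _).mp hE₁
  have h9a₂ := (mem_maximalIdeal_pow_iff_dvd_of_irreducible hϖ _ _).mp hE₂
  have h9a₃ := (mem_maximalIdeal_pow_iff_dvd_of_irreducible hϖ _ _).mp hE₃
  have h9a₆ := (mem_maximalIdeal_pow_iff_dvd_of_irreducible hϖ _ _).mp hE₆
  -- step 9: III*
  by_cases h9t : W₉.a₄ ∈ maximalIdeal R ^ 4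
  swap
  · rw [if_pos h9t]
    exact Or.inr (Or.inr (Or.inl rfl))
  rw [if_neg (not_not.mpr h9t)]
  have h9a₄' := (mem_maximalIdeal_pow_iff_dvd_of_irreducible hϖ _ _).mp h9t
  -- step 10: II* is impossible
  by_cases h10t : W₉.a₆ ∈ maximalIdeal R ^ 6
  swap
  · exfalso
    obtain ⟨α, hα⟩ := h9a₁
    obtain ⟨p, hp⟩ := h9a₂
    obtain ⟨γ, hγ⟩ := h9a₃
    obtain ⟨q, hq⟩ := h9a₄'
    obtain ⟨ρ, hρ⟩ := h9a₆
    have hρu : IsUnit ρ := by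
      rw [isUnit_iff_not_dvd hϖ]
      rintro ⟨ρ', rfl⟩
      exact h10t ((mem_maximalIdeal_pow_iff_dvd_of_irreducible hϖ _ _).mpr ⟨ρ', by rw [hρ]; ring⟩)
    have hb₂ : uniformizer R ^ 2 ∣ W₉.b₂ :=
      ⟨α ^ 2 + 4 * p, by simp only [WeierstrassCurve.b₂, hα, hp]; ring⟩
    have hb₄ : uniformizer R ^ 4 ∣ W₉.b₄ :=
      ⟨2 * q + α * γ, by simp only [WeierstrassCurve.b₄, hα, hγ, hq]; ring⟩
    have hb₆ : W₉.b₆ = uniformizer R ^ 5 * (4 * ρ + uniformizer R * γ ^ 2) := by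
      simp only [WeierstrassCurve.b₆, hγ, hρ]; ring
    exact not_twoTorsionRoot_exitIIstar hϖ h2 W₉ hb₂ hb₄ hb₆
      (isUnit_add_mul_of_isUnit hϖ (h4.mul hρu) _) hx₉
  -- step 11 cannot be reached: W₉ = (C₉ C₈ C₆ C₂) • W with u = 1
  exfalso
  have h9a₆' := (mem_maximalIdeal_pow_iff_dvd_of_irreducible hϖ _ _).mp h10t
  have hW₉ : W₉ = (hex9.choose * hex8.choose * hex6.choose * hex2.choose) • W := by
    simp only [mul_smul]; rfl
  have hu : (hex9.choose * hex8.choose * hex6.choose * hex2.choose).u = 1 := by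
    simp only [WeierstrassCurve.VariableChange.mul_def, hu₂, hu₆, hu₈, hu₉, mul_one]
  refine hmin _ hu ?_ ?_ ?_ ?_ ?_
  · rw [← hW₉]; exact (mem_maximalIdeal_iff_dvd_of_irreducible hϖ _).mp hE₁
  · rw [← hW₉]; exact (mem_maximalIdeal_pow_iff_dvd_of_irreducible hϖ _ _).mp hE₂
  · rw [← hW₉]; exact (mem_maximalIdeal_pow_iff_dvd_of_irreducible hϖ _ _).mp hE₃
  · rw [← hW₉]; exact h9a₄'
  · rw [← hW₉]; exact h9a₆'

/-- **`ord Δ ≤ m + 1` in the presence of a `2`-division root** (DVR with `2 ∈ Rˣ` and perfect residue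
field; minimal equation): by `kodairaSymbolOfMinimal_of_twoTorsionRoot` the type is `I_{ord Δ}`
(`m = ord Δ` or `m = 1, ord Δ = 0`), or `III, III*, Iₙ*`, where `ord Δ = m + 1`
(`addVal_Δ_toNat_eq_numComponents_add_one_of_isUnit_two`). With Ogg's formula as the definition of
`f` this is `f ≤ 2` (Silverman ATAEC IV.10.2(b) for the reduction types with a rational `2`-torsion
point, `p ≠ 2`). [cite: Silverman1994, IV.10.2] -/
theorem addVal_Δ_toNat_le_numComponents_add_one_of_twoTorsionRoot [PerfectField (ResidueField R)]
    (h2 : IsUnit (2 : R)) (W : WeierstrassCurve R) (hΔ0 : W.Δ ≠ 0)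
    (hmin : ∀ C : WeierstrassCurve.VariableChange R, C.u = 1 →
      uniformizer R ∣ (C • W).a₁ → uniformizer R ^ 2 ∣ (C • W).a₂ →
      uniformizer R ^ 3 ∣ (C • W).a₃ → uniformizer R ^ 4 ∣ (C • W).a₄ →
      uniformizer R ^ 6 ∣ (C • W).a₆ → False)
    {x : R} (hx : 4 * x ^ 3 + W.b₂ * x ^ 2 + 2 * W.b₄ * x + W.b₆ = 0) :
    (addVal R W.Δ).toNat ≤ W.kodairaSymbolOfMinimal.numComponents + 1 := by
  rcases kodairaSymbolOfMinimal_of_twoTorsionRoot h2 W hmin hx with h | h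
  · rw [h]
    rcases (addVal R W.Δ).toNat with _ | n
    · simp
    · rw [KodairaSymbol.numComponents_I_succ]; omega
  · rw [addVal_Δ_toNat_eq_numComponents_add_one_of_isUnit_two h2 W hΔ0 h]

/-- The exits `II, IV, IV*, II*` are never reached in the presence of a `2`-division root
(restatement of `kodairaSymbolOfMinimal_of_twoTorsionRoot`). [cite: Silverman1994, IV.9.4 and Table 4.1] -/
theorem kodairaSymbolOfMinimal_ne_of_twoTorsionRoot [PerfectField (ResidueField R)]
    (h2 : IsUnit (2 : R)) (W : WeierstrassCurve R)
    (hmin : ∀ C : WeierstrassCurve.VariableChange R, C.u = 1 →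
      uniformizer R ∣ (C • W).a₁ → uniformizer R ^ 2 ∣ (C • W).a₂ →
      uniformizer R ^ 3 ∣ (C • W).a₃ → uniformizer R ^ 4 ∣ (C • W).a₄ →
      uniformizer R ^ 6 ∣ (C • W).a₆ → False)
    {x : R} (hx : 4 * x ^ 3 + W.b₂ * x ^ 2 + 2 * W.b₄ * x + W.b₆ = 0) :
    W.kodairaSymbolOfMinimal ≠ .II ∧ W.kodairaSymbolOfMinimal ≠ .IV ∧
      W.kodairaSymbolOfMinimal ≠ .IVstar ∧ W.kodairaSymbolOfMinimal ≠ .IIstar := by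
  rcases kodairaSymbolOfMinimal_of_twoTorsionRoot h2 W hmin hx with h | h | h | ⟨n, h⟩ <;>
    rw [h] <;> exact ⟨nofun, nofun, nofun, nofun⟩

end Main

end TateAlgorithm

end Literature.NumberTheory.DiophantineGeometry
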